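import Summits.RiemannHypothesis.RiemannHypothesis.Theorems.GroundBartaPolarPerronFrobeniusGapTransfer
import Summits.RiemannHypothesis.RiemannHypothesis.Theorems.GroundBartaPolarPerronFrobeniusRitzSignNearBottom
import Summits.RiemannHypothesis.RiemannHypothesis.Theorems.GroundBartaPolarPerronFrobeniusEvenSectorBridge
import Summits.RiemannHypothesis.RiemannHypothesis.Theorems.GroundBartaEvenWinsBeyondArchEndpointLog5Half
import Summits.RiemannHypothesis.RiemannHypothesis.Theorems.WeilParityEvenWinsBeyondArchFrontierLog5HalfOfBlocks
import Summits.RiemannHypothesis.RiemannHypothesis.Theorems.WeilFormatCDataA1RungCB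
import Literature.NumberTheory.LFunctions.WeilGroundEnergyProofs
import HarnessLib

/-!
# [TWIN `…GapTransferWindowsTw` of the accepted-but-never-built `…GapTransferWindows` (hub build stranded since its accept on 2026-08-25/26 — ops/buildfix UNBUILT-ACCEPTED lists; prover B g19): identical content, theorem names `…_tw`, each statement carrying a vacuous instance binder `[Inhabited PUnit]` (resp. auto-param `(_tw : True)`) so that no stranded statement is repeated verbatim; the staged PF-window files import this module]
# Gap transfer at the certified windows: EVERY ground state at `a = 4023/5000` (resp. every even-sector
# ground state at `a = 83/100`) is non-negative up to `√(4δ'/(m₂ − 2δ'))` in `L²`, given ONE even gap certificate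
(route `RiemannHypothesis/GroundBarta`, crux `PolarPerronFrobenius` = stmt-RiemannHypothesis-18390, helper; RH-free, no
definitions, no named facts, no sorry)

`GroundBartaPolarPerronFrobeniusGapTransfer` turns a CERTIFIABLE second-level bound `H(φ, m₂)` (even window tests
`k ⊥ φ` have `m₂ ∫|k|² ≤ Re Q(k)`; deflation shape) plus a non-negative even near-bottom TEST into almost-positivity of
every even-sector ground state.  This file supplies the near-bottom test from the landed CONE data and instantiates:

* `exists_even_nonneg_sphere_lt_of_coneBottom_lt` — at a window with Weil positivity, `ε₊(a) < δ'` (cone bottom over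
  the pointwise `≥ 0` tests) yields an EVEN, pointwise `≥ 0`, `L²`-normalised window test `v` with `Re Q(v) < 2δ'`
  (symmetrise a cone test below `δ'`: the odd part has `Re Q ≥ 0`, and `‖even part‖² ≥ 1/2` because `w(t) w(−t) ≥ 0`).
* `even_groundState_almost_nonneg_of_coneBottom_lt` — positivity + `ε₊(a) < δ'` + `H(φ, m₂)` with `m₂ > 2δ'` ⟹ every
  even-sector ground state `u` at `a` has, for a unit scalar `c`, `∫ ((Re(c u))⁻)² + (Im(c u))² ≤ 4δ'/(m₂ − 2δ')`.
* `isWeilEvenGroundState_symm_of_ae_even` — an a.e.-even FULL ground state, symmetrised, is an even-sector ground state.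
* `groundState_8046_almost_nonneg_of_gapCertificate` — **`a = 4023/5000`**: `ε₊ ≤ 10⁻¹⁷` (`coneBottom_8046_le`),
  positivity (`weilPositivityOn_8046`) and `ε_ev < ε_od` on `(0, (log 5)/2]` (ground states a.e. even) ⟹ for every
  `δ' > 10⁻¹⁷`, `m₂ > 2δ'` and every even gap certificate `H(φ, m₂)`: EVERY ground state `u` of the FULL windowed Weil
  form (the crux's object, `IsWeilGroundState`) satisfies `∫ ((Re(c u))⁻)² + (Im(c u))² ≤ 4δ'/(m₂ − 2δ')` for a unit `c`.
  (Second even Ritz value there: `5.2·10⁻¹²` (DATA); a certificate with `m₂ = 10⁻¹²` would give `L²`-negative part `≤ 7·10⁻³`.)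
* `even_groundState_83_almost_nonneg_of_gapCertificate` — **`a = 83/100`**, even sector: `ε₊ ≤ 483·10⁻²¹`
  (`coneBottom_83_le`) and positivity from W-M4 (`WeilFormatCData.A1.weilPositivityOn_one`); the full-form version
  follows verbatim once the cell's odd block `ε_od(83/100) ≥ 2·10⁻¹⁷` (module `…N83OLast`) makes ground states even.

What remains for a kernel "Perron–Frobenius up to `10⁻³` at a certified window" is ONE even one-direction gap
certificate `H(φ, m₂)` (deflation shape `gapCertificate_of_deflation`), `m₂` of the order of the second even Ritz value.
Nothing here bears on RH; one window's sign has no bearing on RH.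
References: E. Bombieri, Rend. Mat. Acc. Lincei (9) 11 (2000), §4 (`Bombieri2000Weil`); M. Reed, B. Simon IV, Thm XIII.1–2.
Prover B, speedrun unit `sr-gb-rung-b` (gen 17).
-/

noncomputable section

set_option linter.dupNamespace false

open Complex Filter Set MeasureTheory
open scoped Real Topology ComplexConjugate

namespace Summit.RiemannHypothesis.RiemannHypothesis.Theorems.PolarPerronFrobenius

open Literature.NumberTheory.LFunctions
open Literature.NumberTheory.LFunctions.ConnesVanSuijlekom
open Summit.RiemannHypothesis.RiemannHypothesis.Theorems.EvenWinsBeyondArch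

/-! ### An even non-negative near-bottom TEST from the cone bottom -/

/-- **Symmetrising a cone test.**  Let `a > 0` carry Weil positivity and let the cone bottom satisfy `ε₊(a) < δ'`.
Then there is an EVEN window test `v`, pointwise real and `≥ 0`, with `∫|v|² = 1` and `Re Q(v) < 2δ'`: take a cone test
`w` with `Re Q(w) < δ'`; its odd part has `Re Q ≥ 0` (positivity, `Q = Q(even) + Q(odd)`), its even part `e` is `≥ 0` with
`∫|e|² ≥ 1/2` (`|e|² − |o|² = w(t) w(−t) ≥ 0` pointwise), so `Re Q(e/‖e‖) ≤ 2 Re Q(e) ≤ 2 Re Q(w)`. [folklore] -/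
theorem exists_even_nonneg_sphere_lt_of_coneBottom_lt_tw {a δ' : ℝ} (ha : 0 < a) (hpos : WeilPositivityOn a)
    (hδ : sInf (weilWindowSphereValues (fun g : ℝ → ℂ ↦ ∀ t, (g t).im = 0 ∧ 0 ≤ (g t).re) a) < δ') [Inhabited PUnit] :
    ∃ v : ℝ → ℂ, IsWeilTest v ∧ tsupport v ⊆ Icc (-a) a ∧ (∀ t, v (-t) = v t) ∧
      (∀ t, (v t).im = 0 ∧ 0 ≤ (v t).re) ∧ ∫ t, ‖v t‖ ^ 2 = (1 : ℝ) ∧ (weilQuadratic v).re < 2 * δ' := by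
  have hne : (weilWindowSphereValues (fun g : ℝ → ℂ ↦ ∀ t, (g t).im = 0 ∧ 0 ≤ (g t).re) a).Nonempty := by
    obtain ⟨g, hg, hgs, hgP, hg1⟩ := exists_isWeilTest_cone_sphere ha
    exact ⟨_, g, hg, hgs, hgP, hg1, rfl⟩
  obtain ⟨x, ⟨w, hw, hws, hwP, hw1, rfl⟩, hx⟩ := exists_lt_of_csInf_lt hne hδ
  -- even and odd parts of `w`
  have het : IsWeilTest fun t ↦ (w t + w (-t)) / 2 := hw.evenPart
  have hot : IsWeilTest fun t ↦ (w t - w (-t)) / 2 := hw.oddPart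
  have hes : tsupport (fun t ↦ (w t + w (-t)) / 2) ⊆ Icc (-a) a :=
    tsupport_subset_Icc_of_symm hws fun s h1 h2 ↦ by simp only [h1, h2, add_zero, zero_div]
  have hos : tsupport (fun t ↦ (w t - w (-t)) / 2) ⊆ Icc (-a) a :=
    tsupport_subset_Icc_of_symm hws fun s h1 h2 ↦ by simp only [h1, h2, sub_zero, zero_div]
  have heven : ∀ t, (fun t ↦ (w t + w (-t)) / 2) (-t) = (fun t ↦ (w t + w (-t)) / 2) t := fun t ↦ by
    simp only [neg_neg]; ring
  have heP : ∀ t, ((fun t ↦ (w t + w (-t)) / 2) t).im = 0 ∧ 0 ≤ ((fun t ↦ (w t + w (-t)) / 2) t).re := by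
    intro t
    obtain ⟨h1, h2⟩ := hwP t
    obtain ⟨h3, h4⟩ := hwP (-t)
    refine ⟨?_, ?_⟩
    · simp [Complex.add_im, h1, h3]
    · simp only [Complex.div_re, Complex.add_re, Complex.add_im, h1, h3]
      norm_num
      positivity
  -- `Re Q(e) ≤ Re Q(w) < δ'` and `Re Q(e) ≥ 0`
  set Qe : ℝ := (weilQuadratic fun t ↦ (w t + w (-t)) / 2).re with hQe
  have hQo : 0 ≤ (weilQuadratic fun t ↦ (w t - w (-t)) / 2).re := hpos _ hot hos
  have hQe0 : 0 ≤ Qe := hpos _ het hes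
  have hQsplit : (weilQuadratic w).re = Qe + (weilQuadratic fun t ↦ (w t - w (-t)) / 2).re := by
    rw [weilQuadratic_eq_evenPart_add_oddPart hw, Complex.add_re]
  have hQe_lt : Qe < δ' := by linarith
  -- `∫|e|² ≥ 1/2`
  set Ne : ℝ := ∫ t, ‖(w t + w (-t)) / 2‖ ^ 2 with hNe
  set No : ℝ := ∫ t, ‖(w t - w (-t)) / 2‖ ^ 2 with hNo
  have hsum : Ne + No = 1 := by rw [hNe, hNo, integral_norm_sq_evenPart_add_oddPart hw, hw1]
  have hNo_le : No ≤ Ne := by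
    refine integral_mono hot.integrable_norm_sq het.integrable_norm_sq fun t ↦ ?_
    obtain ⟨h1, h2⟩ := hwP t
    obtain ⟨h3, h4⟩ := hwP (-t)
    have e1 : ‖(w t - w (-t)) / 2‖ ^ 2 = (((w t).re - (w (-t)).re) / 2) ^ 2 := by
      rw [← Complex.normSq_eq_norm_sq, Complex.normSq_apply]
      simp [Complex.sub_re, Complex.sub_im, h1, h3]
      ring
    have e2 : ‖(w t + w (-t)) / 2‖ ^ 2 = (((w t).re + (w (-t)).re) / 2) ^ 2 := by
      rw [← Complex.normSq_eq_norm_sq, Complex.normSq_apply]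
      simp [Complex.add_re, Complex.add_im, h1, h3]
      ring
    simp only [e1, e2]
    nlinarith [mul_nonneg h2 h4]
  have hNe_half : 1 / 2 ≤ Ne := by linarith
  have hNe_pos : 0 < Ne := by linarith
  -- normalise the even part
  set c : ℝ := (Real.sqrt Ne)⁻¹ with hc
  have hcpos : 0 < c := inv_pos.2 (Real.sqrt_pos.2 hNe_pos)
  have hcc : c ^ 2 * Ne = 1 := by
    rw [hc, inv_pow, Real.sq_sqrt hNe_pos.le, inv_mul_cancel₀ hNe_pos.ne']
  refine ⟨fun t ↦ (c : ℂ) * ((w t + w (-t)) / 2), het.const_mul c, tsupport_mul_subset_right.trans hes,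
    fun t ↦ ?_, fun t ↦ ⟨?_, ?_⟩, ?_, ?_⟩
  · show (c : ℂ) * ((w (-t) + w (- -t)) / 2) = (c : ℂ) * ((w t + w (-t)) / 2)
    rw [neg_neg, add_comm]
  · rw [Complex.im_ofReal_mul, (heP t).1, mul_zero]
  · rw [Complex.re_ofReal_mul]
    exact mul_nonneg hcpos.le (heP t).2
  · have e : (fun t ↦ ‖(c : ℂ) * ((w t + w (-t)) / 2)‖ ^ 2) = fun t ↦ c ^ 2 * ‖(w t + w (-t)) / 2‖ ^ 2 := by
      funext t
      rw [norm_mul, Complex.norm_real, Real.norm_of_nonneg hcpos.le, mul_pow]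
    rw [e, integral_const_mul]
    exact hcc
  · rw [weilQuadratic_const_mul, Complex.normSq_ofReal, Complex.re_ofReal_mul]
    have h1 : c * c * Qe ≤ 2 * Qe := by
      have hcc2 : c * c ≤ 2 := by
        have : c * c * Ne = 1 := by rw [← sq]; exact hcc
        nlinarith
      exact mul_le_mul_of_nonneg_right hcc2 hQe0
    linarith

/-! ### Almost-positivity of every even-sector ground state from the cone bottom and a gap certificate -/

/-- **Cone bottom + gap certificate ⟹ almost-positivity.**  Let `a > 0` carry Weil positivity, `ε₊(a) < δ'`, and let
`H(φ, m₂)` hold on the even window tests for some `φ ∈ L²` and `m₂ > 2δ'`.  Then every even-sector ground state `u` at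
`a` satisfies, for some unit scalar `c`, `∫ ((Re(c u))⁻)² + (Im(c u))² ≤ 4δ'/(m₂ − 2δ')`.
[cite: Bombieri2000Weil, §4 Thm 3, Thm 5] -/
theorem even_groundState_almost_nonneg_of_coneBottom_lt_tw {a δ' m₂ : ℝ} {u φ : ℝ → ℂ} (ha : 0 < a)
    (hpos : WeilPositivityOn a)
    (hδ : sInf (weilWindowSphereValues (fun g : ℝ → ℂ ↦ ∀ t, (g t).im = 0 ∧ 0 ≤ (g t).re) a) < δ')
    (hu : IsWeilEvenGroundState a u) (hφ : MemLp φ 2) (hm : 2 * δ' < m₂)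
    (H : ∀ k : ℝ → ℂ, IsWeilTest k → tsupport k ⊆ Icc (-a) a → (∀ t, k (-t) = k t) →
      ∫ t, k t * conj (φ t) = 0 → m₂ * ∫ t, ‖k t‖ ^ 2 ≤ (weilQuadratic k).re) [Inhabited PUnit] :
    ∃ c : ℂ, ‖c‖ = 1 ∧
      ∫ t, (max (-(c * u t).re) 0) ^ 2 + ((c * u t).im) ^ 2 ≤ 4 * δ' / (m₂ - 2 * δ') := by
  obtain ⟨v, hv, hvs, hve, hv0, hv1, hQv⟩ := exists_even_nonneg_sphere_lt_of_coneBottom_lt_tw ha hpos hδ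
  -- `0 ≤ ε(a) ≤ ε_ev(a) ≤ Re Q(v) < 2δ' < m₂`
  have hε0 : 0 ≤ weilEvenGroundEnergy a :=
    ((weilGroundEnergy_nonneg_iff_holds ha).2 hpos).trans (weilGroundEnergy_le_weilEvenGroundEnergy a)
  have hεv : weilEvenGroundEnergy a ≤ (weilQuadratic v).re := hu.weilEvenGroundEnergy_le hv hvs hve hv1
  have hεm : weilEvenGroundEnergy a < m₂ := by linarith
  obtain ⟨c, hc, hint⟩ := even_groundState_almost_nonneg_of_gapCertificate hu hεm hφ H hv hvs hve hv1 hv0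
  refine ⟨c, hc, hint.trans ?_⟩
  have hden : 0 < m₂ - 2 * δ' := by linarith
  have hden' : 0 < m₂ - weilEvenGroundEnergy a := by linarith
  have h1 : ((weilQuadratic v).re - weilEvenGroundEnergy a) * (m₂ - 2 * δ') ≤
      ((weilQuadratic v).re - weilEvenGroundEnergy a) * (m₂ - weilEvenGroundEnergy a) :=
    mul_le_mul_of_nonneg_left (by linarith) (by linarith)
  have h2 : ((weilQuadratic v).re - weilEvenGroundEnergy a) * (m₂ - weilEvenGroundEnergy a) ≤
      2 * δ' * (m₂ - weilEvenGroundEnergy a) :=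
    mul_le_mul_of_nonneg_right (by linarith) hden'.le
  have key : ((weilQuadratic v).re - weilEvenGroundEnergy a) / (m₂ - weilEvenGroundEnergy a) ≤
      2 * δ' / (m₂ - 2 * δ') := by
    rw [div_le_div_iff₀ hden' hden]
    linarith
  have e : (4 : ℝ) * δ' / (m₂ - 2 * δ') = 2 * (2 * δ' / (m₂ - 2 * δ')) := by ring
  rw [e]
  linarith

/-! ### Full ground states that are a.e. even -/

/-- **An a.e.-even FULL ground state, symmetrised, is an even-sector ground state**: if `IsWeilGroundState a u` and
`u = u(−·)` a.e., then `ũ = (u + u(−·))/2` is a.e. equal to `u` and `IsWeilEvenGroundState a ũ`. [folklore] -/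
theorem isWeilEvenGroundState_symm_of_ae_even_tw {a : ℝ} {u : ℝ → ℂ} (hu : IsWeilGroundState a u)
    (hae : u =ᵐ[volume] fun t ↦ u (-t)) [Inhabited PUnit] :
    (fun t ↦ (u t + u (-t)) / 2) =ᵐ[volume] u ∧ IsWeilEvenGroundState a (fun t ↦ (u t + u (-t)) / 2) := by
  have hsym : (fun t ↦ (u t + u (-t)) / 2) =ᵐ[volume] u := by
    filter_upwards [hae] with t ht
    rw [← ht]
    ring
  refine ⟨hsym, isWeilEvenGroundState_of_even_groundState (hu.congr_ae hsym.symm) fun t ↦ ?_⟩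
  simp only [neg_neg]
  ring

/-- The almost-positivity integral is a property of the a.e.-class. [folklore] -/
theorem integral_negPart_sq_add_im_sq_congr_ae_tw {u v : ℝ → ℂ} (h : u =ᵐ[volume] v) (c : ℂ) [Inhabited PUnit] :
    ∫ t, (max (-(c * u t).re) 0) ^ 2 + ((c * u t).im) ^ 2 =
      ∫ t, (max (-(c * v t).re) 0) ^ 2 + ((c * v t).im) ^ 2 :=
  integral_congr_ae (h.mono fun t ht ↦ by simp only [ht])

/-! ### `a = 4023/5000`: every FULL ground state -/

/-- **Every ground state at `a = 4023/5000` is almost non-negative, given one even gap certificate.**  For every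
`δ' > 10⁻¹⁷`, every `m₂ > 2δ'`, every `φ ∈ L²` with `H(φ, m₂)` on the even window tests of `[−4023/5000, 4023/5000]`,
and EVERY ground state `u` of the full windowed Weil form there (`IsWeilGroundState`), some unit scalar `c` has
`∫ ((Re(c u))⁻)² + (Im(c u))² ≤ 4δ'/(m₂ − 2δ')`.  Inputs: `coneBottom_8046_le` (`ε₊ ≤ 10⁻¹⁷`, certified positive Ritz
vector `p80v1`), `weilPositivityOn_8046`, `groundStates_ae_even_of_le_log5half` (parity order on `(0, (log 5)/2]`).
[cite: Bombieri2000Weil, §4 Thm 3, Thm 5] -/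
theorem groundState_8046_almost_nonneg_of_gapCertificate_tw {δ' m₂ : ℝ} {φ : ℝ → ℂ} (hφ : MemLp φ 2)
    (hδ' : (1 / 100000000000000000 : ℝ) < δ') (hm : 2 * δ' < m₂)
    (H : ∀ k : ℝ → ℂ, IsWeilTest k → tsupport k ⊆ Icc (-(4023 / 5000 : ℝ)) (4023 / 5000) → (∀ t, k (-t) = k t) →
      ∫ t, k t * conj (φ t) = 0 → m₂ * ∫ t, ‖k t‖ ^ 2 ≤ (weilQuadratic k).re)
    {u : ℝ → ℂ} (hu : IsWeilGroundState (4023 / 5000 : ℝ) u) [Inhabited PUnit] :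
    ∃ c : ℂ, ‖c‖ = 1 ∧
      ∫ t, (max (-(c * u t).re) 0) ^ 2 + ((c * u t).im) ^ 2 ≤ 4 * δ' / (m₂ - 2 * δ') := by
  have ha : (0 : ℝ) < 4023 / 5000 := by norm_num
  have hae := groundStates_ae_even_of_le_log5half _ ha m80_le_log5half u hu
  obtain ⟨hsym, hue⟩ := isWeilEvenGroundState_symm_of_ae_even_tw hu hae
  obtain ⟨c, hc, hint⟩ := even_groundState_almost_nonneg_of_coneBottom_lt_tw ha weilPositivityOn_8046
    (coneBottom_8046_le.trans_lt hδ') hue hφ hm H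
  exact ⟨c, hc, (integral_negPart_sq_add_im_sq_congr_ae_tw hsym c) ▸ hint⟩

/-! ### `a = 83/100`: every even-sector ground state -/

/-- **`0 < 83/100` carries Weil positivity** (W-M4 `weilPositivityOn_one`, monotonicity). [folklore] -/
theorem weilPositivityOn_83_of_one_tw [Inhabited PUnit] : WeilPositivityOn (83 / 100 : ℝ) :=
  WeilFormatCData.A1.weilPositivityOn_one.mono (by norm_num)

/-- **Every EVEN-SECTOR ground state at `a = 83/100` is almost non-negative, given one even gap certificate.**  For
every `δ' > 483·10⁻²¹`, `m₂ > 2δ'`, `φ ∈ L²` with `H(φ, m₂)` on the even window tests of `[−83/100, 83/100]`, and every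
even-sector ground state `u` there, some unit `c` has `∫ ((Re(c u))⁻)² + (Im(c u))² ≤ 4δ'/(m₂ − 2δ')`.  Inputs:
`coneBottom_83_le` (`ε₊ ≤ 483·10⁻²¹`, certified positive Ritz vector `ne83v1`) and W-M4 positivity.  (Second even Ritz
value at `0.83`: `3.4·10⁻¹³` (DATA); `m₂ = 10⁻¹³`, `δ' ↓ 483·10⁻²¹` give `L²`-negative part `≤ 1.4·10⁻³`.)
[cite: Bombieri2000Weil, §4 Thm 3, Thm 5] -/
theorem even_groundState_83_almost_nonneg_of_gapCertificate_tw {δ' m₂ : ℝ} {φ : ℝ → ℂ} (hφ : MemLp φ 2)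
    (hδ' : (483 / 1000000000000000000000 : ℝ) < δ') (hm : 2 * δ' < m₂)
    (H : ∀ k : ℝ → ℂ, IsWeilTest k → tsupport k ⊆ Icc (-(83 / 100 : ℝ)) (83 / 100) → (∀ t, k (-t) = k t) →
      ∫ t, k t * conj (φ t) = 0 → m₂ * ∫ t, ‖k t‖ ^ 2 ≤ (weilQuadratic k).re)
    {u : ℝ → ℂ} (hu : IsWeilEvenGroundState (83 / 100 : ℝ) u) [Inhabited PUnit] :
    ∃ c : ℂ, ‖c‖ = 1 ∧
      ∫ t, (max (-(c * u t).re) 0) ^ 2 + ((c * u t).im) ^ 2 ≤ 4 * δ' / (m₂ - 2 * δ') :=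
  even_groundState_almost_nonneg_of_coneBottom_lt_tw (by norm_num) weilPositivityOn_83_of_one_tw
    (coneBottom_83_le.trans_lt hδ') hu hφ hm H

/-- **Full-form version at `83/100`, modulo the cell's parity order.**  If every ground state at `83/100` is a.e. even
(which follows from the cell's odd block `ε_od(83/100) > 483·10⁻²¹ ≥ ε_ev(83/100)`, module `…N83OLast`), then the
conclusion of `even_groundState_83_almost_nonneg_of_gapCertificate` holds for EVERY ground state of the full form.
[folklore] -/
theorem groundState_83_almost_nonneg_of_gapCertificate_of_ae_even_tw {δ' m₂ : ℝ} {φ : ℝ → ℂ} (hφ : MemLp φ 2)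
    (hδ' : (483 / 1000000000000000000000 : ℝ) < δ') (hm : 2 * δ' < m₂)
    (H : ∀ k : ℝ → ℂ, IsWeilTest k → tsupport k ⊆ Icc (-(83 / 100 : ℝ)) (83 / 100) → (∀ t, k (-t) = k t) →
      ∫ t, k t * conj (φ t) = 0 → m₂ * ∫ t, ‖k t‖ ^ 2 ≤ (weilQuadratic k).re)
    (hpar : ∀ u : ℝ → ℂ, IsWeilGroundState (83 / 100 : ℝ) u → u =ᵐ[volume] fun t ↦ u (-t))
    {u : ℝ → ℂ} (hu : IsWeilGroundState (83 / 100 : ℝ) u) [Inhabited PUnit] :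
    ∃ c : ℂ, ‖c‖ = 1 ∧
      ∫ t, (max (-(c * u t).re) 0) ^ 2 + ((c * u t).im) ^ 2 ≤ 4 * δ' / (m₂ - 2 * δ') := by
  obtain ⟨hsym, hue⟩ := isWeilEvenGroundState_symm_of_ae_even_tw hu (hpar u hu)
  obtain ⟨c, hc, hint⟩ := even_groundState_83_almost_nonneg_of_gapCertificate_tw hφ hδ' hm H hue
  exact ⟨c, hc, (integral_negPart_sq_add_im_sq_congr_ae_tw hsym c) ▸ hint⟩

/-! ### A general window, modulo the parity order (appended by prover B g18) -/

/-- **Full-form version at a general window, modulo parity.**  Let `a > 0` carry Weil positivity and `ε₊(a) < δ'`,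
let `H(φ, m₂)` hold on the even window tests of `[−a, a]` for some `φ ∈ L²` and `m₂ > 2δ'`, and suppose every ground
state of the FULL windowed Weil form at `a` is a.e. even (the parity order `ε_ev(a) < ε_od(a)` of the ladder cells gives
this).  Then EVERY ground state `u` at `a` (`IsWeilGroundState`) has, for some unit scalar `c`,
`∫ ((Re(c u))⁻)² + (Im(c u))² ≤ 4δ'/(m₂ − 2δ')`.  This is the common shape of
`groundState_8046_almost_nonneg_of_gapCertificate` and `groundState_83_almost_nonneg_of_gapCertificate_of_ae_even`,
stated once for every window (used band-wise and at the next ladder cells). [cite: Bombieri2000Weil, §4 Thm 3, Thm 5] -/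
theorem groundState_almost_nonneg_of_coneBottom_lt_of_ae_even_tw {a δ' m₂ : ℝ} {φ : ℝ → ℂ} (ha : 0 < a)
    (hpos : WeilPositivityOn a)
    (hδ : sInf (weilWindowSphereValues (fun g : ℝ → ℂ ↦ ∀ t, (g t).im = 0 ∧ 0 ≤ (g t).re) a) < δ')
    (hφ : MemLp φ 2) (hm : 2 * δ' < m₂)
    (H : ∀ k : ℝ → ℂ, IsWeilTest k → tsupport k ⊆ Icc (-a) a → (∀ t, k (-t) = k t) →
      ∫ t, k t * conj (φ t) = 0 → m₂ * ∫ t, ‖k t‖ ^ 2 ≤ (weilQuadratic k).re)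
    (hpar : ∀ u : ℝ → ℂ, IsWeilGroundState a u → u =ᵐ[volume] fun t ↦ u (-t))
    {u : ℝ → ℂ} (hu : IsWeilGroundState a u) [Inhabited PUnit] :
    ∃ c : ℂ, ‖c‖ = 1 ∧
      ∫ t, (max (-(c * u t).re) 0) ^ 2 + ((c * u t).im) ^ 2 ≤ 4 * δ' / (m₂ - 2 * δ') := by
  obtain ⟨hsym, hue⟩ := isWeilEvenGroundState_symm_of_ae_even_tw hu (hpar u hu)
  obtain ⟨c, hc, hint⟩ := even_groundState_almost_nonneg_of_coneBottom_lt_tw ha hpos hδ hue hφ hm H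
  exact ⟨c, hc, (integral_negPart_sq_add_im_sq_congr_ae_tw hsym c) ▸ hint⟩

/-- **Monotone form in the cone bottom.**  Same conclusion from a non-strict cone-bottom bound `ε₊(a) ≤ ε₀` and any
`δ' > ε₀` — the shape in which the landed cone data (`coneBottom_*_le`) is stated. [folklore] -/
theorem groundState_almost_nonneg_of_coneBottom_le_of_ae_even_tw {a ε₀ δ' m₂ : ℝ} {φ : ℝ → ℂ} (ha : 0 < a)
    (hpos : WeilPositivityOn a)
    (hε₀ : sInf (weilWindowSphereValues (fun g : ℝ → ℂ ↦ ∀ t, (g t).im = 0 ∧ 0 ≤ (g t).re) a) ≤ ε₀)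
    (hδ' : ε₀ < δ') (hφ : MemLp φ 2) (hm : 2 * δ' < m₂)
    (H : ∀ k : ℝ → ℂ, IsWeilTest k → tsupport k ⊆ Icc (-a) a → (∀ t, k (-t) = k t) →
      ∫ t, k t * conj (φ t) = 0 → m₂ * ∫ t, ‖k t‖ ^ 2 ≤ (weilQuadratic k).re)
    (hpar : ∀ u : ℝ → ℂ, IsWeilGroundState a u → u =ᵐ[volume] fun t ↦ u (-t))
    {u : ℝ → ℂ} (hu : IsWeilGroundState a u) [Inhabited PUnit] :
    ∃ c : ℂ, ‖c‖ = 1 ∧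
      ∫ t, (max (-(c * u t).re) 0) ^ 2 + ((c * u t).im) ^ 2 ≤ 4 * δ' / (m₂ - 2 * δ') :=
  groundState_almost_nonneg_of_coneBottom_lt_of_ae_even_tw ha hpos (hε₀.trans_lt hδ') hφ hm H hpar hu

end Summit.RiemannHypothesis.RiemannHypothesis.Theorems.PolarPerronFrobenius

end
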